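import Summits.QuantumFields.YangMills.Theorems.HyperbolicRegulatorCurvatureUniformity
import Summits.QuantumFields.YangMills.Theorems.HyperbolicRegulatorCurvatureAnchorRefutation

/-!
# Disproof of `CurvatureUniformity` (stmt-QuantumFields-15825, route `HyperbolicRegulator`) — findings

cdisprove seat `refuter-cdisprove-stmt-QuantumFields-15825-0`, cycle 1, 2026-08-17.

## Verdict: NO KILL IS POSSIBLE — the crux AS TYPED is a theorem (vacuously)

The route decl `Summit.QuantumFields.YangMills.Theses.HyperbolicRegulator.CurvatureUniformity` is
`∀ G (compact simple) r family, H_adm → H_anchor → T` with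
`H_adm := ∀ k j, 8 ≤ k → (Φ k j).1` ("the family is ADMISSIBLE at every curvature scale `k ≥ 8` and every
separation index `j`").  The admissibility predicate (named `NoAdmissibleComplex.Adm`, byte for byte the crux's
inlined `(Fam …).1`) is UNSATISFIABLE at every scale `k ≥ 208` for ALL data
(`NoAdmissibleComplex.no_admissible`, tree `Theorems/HyperbolicRegulatorHyperbolicToTorus.lean`: the flatness
threshold `k/4 < dist x c` coincides with the sup-radius `k/4` of the injective `ℤ²`-charts, and double counting
the first flat shell around a cone gives `k/4 − 1 ≤ 50`).  Hence:

* the item was CLOSED `proved` at 2026-08-17T12:49:06Z by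
  `Cruxes.CurvatureUniformity.NoAdmissibleComplex.CurvatureUniformity_of_no_admissible`
  (tree `Theorems/HyperbolicRegulatorCurvatureUniformity.lean`), three minutes after this seat was created;
* `¬ CurvatureUniformity` is kernel-excluded (`not_not_curvatureUniformity` below) — there is nothing to refute;
* the sibling `CurvatureAnchor` (stmt-15826, `∃ family, H_adm ∧ …`) is REFUTED-MISSTATED by the same lemma
  (`Theorems.not_CurvatureAnchor`), the route is BROKEN since 12:49:08Z, and a LOCKSTEP RESTATE of the shared
  `Fam` vocabulary of 15825/15826/15827 is pending (planner repair grace 72 h).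

## Findings index (what the provers / the restating planner / the next disprover should read)

1. `hypotheses_unsatisfiable`, `withConclusion_all` — VACUITY CERTIFICATE (protocol §3b): the hypotheses of the
   crux are jointly unsatisfiable; the crux holds with ANY conclusion `T`, in particular with `T := False`.
2. LOAD-BEARING ANALYSIS (protocol (a)) — degenerate for this typing: the ONLY load-bearing hypothesis is `H_adm`
   at ONE scale `k ≥ 208` (`j` arbitrary).  `IsCompactSimpleLieGroup G`, the representation `r`, the anchor
   hypothesis `H_anchor` (rate `c/k` at `β ≥ β₀(k)`), and `β ≥ β₁` are ALL idle.  Consequently no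
   `curvatureUniformity_false_without_<H>` theorem exists for `H ≠ H_adm` (dropping such an `H` leaves a TRUE
   statement), and `…WithoutAdm` (drop admissibility entirely, keep the anchor) is not cheaply decidable either:
   junk data (no edges / empty flat set / `X` constant) make the clustering predicate `(Φ k j).2` vacuous or an
   identity `|ab − ab| ≤ C`, i.e. TRUE again, and non-junk data are genuine Wilson integrals on `S × S`.
3. THRESHOLD BOOKKEEPING as kernel-checked arithmetic (protocol (b), for the restating seat):
   `old_slip_iff` (the typed slip bites exactly for `k ≥ 12`: a flat vertex at distance `k/4 + 1` from a cone has
   the cone at an INTERIOR point of its chart box), `repaired_reach_le_flat` (R-a: a chart box of sup-radius `k/4`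
   has graph reach `2(k/4) ≤ k/2`, so with the repaired flat threshold `k/2 < dist` no cone enters a flat chart),
   `support_fits_chart` (chart-read observables of support radius `k/8` read only chart edges, `k ≥ 8`),
   `deep_threshold_lt_density` (the repaired deep threshold `3(k/4)` is below the cone-density radius `k`, so deep
   vertices are not excluded by clause 5; realised: see 4(ii)).
4. PRE-RESTATE VACUITY / JUNK AUDIT of the proposed repaired clauses R-a / R-b / R-c
   (`Cruxes/CurvatureUniformity/StrategistSketch.lean` §3, `RESTATE-ADVICE.md`; C′ of `not_CurvatureAnchor`)
   against the INTENDED model — the universal cover of the `k`-subdivided `{4,5}` square complex, built exactly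
   (right-angled pentagon Coxeter group in its Tits representation, integer matrices; patch of 7 981 / 20 901
   pentagons = `{4,5}` vertices; scripts `comp/balls45.py`, `comp/chi_sample.py`, table `CHI-BALLS.md`, all in
   this seat's folder and attached as item evidence):
   (i)  clauses 5/6 are TIGHT BUT CONSISTENT: max nearest-cone distance = `k` exactly (`k = 2,4,6,8`; clause 5
        needs `≤ k`), min cone–cone distance = `k` exactly (clause 6 needs `≥ k`); every interior big vertex has
        degree 5, every small vertex degree 4;
   (ii) R-a: flat vertices (`k/2 < d_cone`) and repaired-deep vertices (`3(k/4) < d_cone`) exist for every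
        tested `k` (e.g. `k = 8`: 6 050 flat / 825 deep vertices in the inner patch);
   (iii) R-c (disc clause `χ(B(x,r)) = #V − #E + #Q = 1`): `χ = 1` for EVERY tested ball — `k = 1..8`, five
        structured centres (cone, cone-neighbour, first flat shell, deepest, `d_cone = 2`) plus 60–150 random
        centres per `k`, all radii up to `≈ 6k` inside the patch, > 4 000 (centre, radius) pairs, 0 deviations —
        so the intended geometry satisfies R-c below the injectivity radius (finite covers need graph systole
        `> j + 2`, available along congruence / conditioned-random towers);
   (iv) R-b (cone charts of radius `k/2`, onto `B(c, k/2)`): consistent — the star of the five big squares at `c`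
        has its frontier at distance `≥ k > k/2`, the five rays are shared as typed (`a = 0` of quadrant `s` =
        `b = 0` of quadrant `s+1`), injectivity needs only systole `> k`.
   NO SLIP of the "flat threshold = chart radius" kind was found in R-a / R-b / R-c.  What the audit does NOT
   cover: the Poincaré constant `10⁶k²` uniformly in `j` (needs the expander input, arXiv:2003.10911-type; the
   header's estimate `≈ 25k²`, mine `≈ 4.3k²/λ₁(S)`), and large-systole covers — i.e. exactly the combinatorial
   half of the restated `CurvatureAnchor`, true as mathematics, XL to formalise.  So after the restate the
   ∀-cruxes are non-vacuous in truth but will not be PROVABLY non-vacuous in the tree for a long time; a second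
   vacuous closure cannot recur unless a new slip is introduced by the restate itself — re-run this audit on the
   restated text.
5. EXPOSURES of the RESTATED crux (prose; what the re-armed disprover attacks first):
   E1 abelian test — the intended statement is FALSE for `U(1)` (expander photon mass `≍ 1/k → 0`), excluded
      only by `IsCompactSimpleLieGroup`; so non-abelianness is load-bearing for any proof (barrier
      `Literature.Barriers.QuantumFields.AbelianDeconfinementD4`), but no Lean-level kill: simple `G` admits no
      junk model (connected, non-abelian, faithful unitary rep).
   E2 flat bands / finite temperature (strategist N1) — switched off by R-c.  Without R-c: a band of bounded length
      `ℓ₀` is a bounded region of ITS factor (absorbed into `C(A,B,k)` for separations inside that factor), so it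
      could bite only through separation along the OTHER factor inside `band × S` — Wilson's theory at temporal
      extent `ℓ₀k` over a hyperbolic transverse complex; whether that deconfines sharply as `j → ∞` is itself
      unclear.  Keep R-c regardless (15826's toron suppression needs it).
   E3 O-band (`∀ k ≥ 8` with `k`-uniform onset `β₁`; strategist N2: a first-order bulk transition of the scale-`k`
      regulated theory at `β_t(k) → ∞` gives phase coexistence in the `j → ∞` state at `β = β_t(k) ≥ β₁`, hence
      no clustering at that `k`) — the ONE physics-level kill of simple-`G` content short of the flat mass gap;
      it is logically idle for `closes` (REGLUE-ADVICE: `HyperbolicToTorus` consumes only `k → ∞`).  Disprover's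
      reading: restating 15825/15827 to the I-core tail `∃ K, ∀ k ≥ K` removes E3 — and with it the only
      refutable surface of the crux; what remains (E4) is irrefutable by cheap means.
   E4 I-core = weak-coupling volume-uniform flat mass gap (balls of radius `k/4 → ∞`) + hyperbolic-vs-flat state
      identification: no counterexample search is possible (infinite measure-theoretic `∀∃`; MC uncertifiable;
      VETTING 2026-08-17); negatives index (6 entries) untouched.

Nothing in this file is proposed to `Theorems/`: items 15825/15827 are closed, 15826 refuted; the negative content
(`no_admissible`, `not_CurvatureAnchor`) is already in the tree and is IMPORTED, not re-proved.
-/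

set_option autoImplicit false

namespace Summit.QuantumFields.YangMills.Cruxes.CurvatureUniformity.Disproof

open Literature.MathematicalPhysics.QuantumFieldTheory Literature.MathematicalPhysics.QuantumLattice
open Summit.QuantumFields.YangMills.Cruxes.HyperbolicToTorus.NoAdmissibleComplex

/-! ## 1. Vacuity certificate -/

/-- **The hypotheses of `CurvatureUniformity` are jointly unsatisfiable.**  For ANY family data, admissibility at
all scales `k ≥ 8` (the crux's `H_adm`, with `Adm` = the crux's inlined `(Fam …).1`) is contradictory: instantiate
at `k = 208`, `j = 0` and apply the tree's `NoAdmissibleComplex.no_admissible`.  Neither the group, nor the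
representation, nor the anchor hypothesis, nor `β` occurs. -/
theorem hypotheses_unsatisfiable
    (V E Q : ℕ → ℕ → Finset ℕ) (σ τ : ℕ → ℕ → ℕ → ℕ) (bd : ℕ → ℕ → ℕ → Fin 4 → ℕ × Bool)
    (cV : ℕ → ℕ → ℕ → ℤ × ℤ → ℕ) (cE : ℕ → ℕ → ℕ → ℤ × ℤ → Fin 2 → ℕ × Bool)
    (hAdm : ∀ k j, 8 ≤ k → Adm k j (V k j) (E k j) (Q k j) (σ k j) (τ k j) (bd k j) (cV k j) (cE k j)) :
    False :=
  no_admissible 208 0 _ _ _ _ _ _ _ _ le_rfl (hAdm 208 0 (by norm_num))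

/-- The crux with its conclusion REPLACED by an arbitrary proposition `T` (group, simplicity, representation and
family quantified exactly as in the route decl; the anchor hypothesis is omitted since it is not needed). -/
def WithConclusion (T : Prop) : Prop :=
  ∀ (G : Type) [Group G] [TopologicalSpace G] [IsTopologicalGroup G] [CompactSpace G],
    IsCompactSimpleLieGroup G → ∀ _r : LatticeRep G,
    ∀ (V E Q : ℕ → ℕ → Finset ℕ) (σ τ : ℕ → ℕ → ℕ → ℕ) (bd : ℕ → ℕ → ℕ → Fin 4 → ℕ × Bool)
      (cV : ℕ → ℕ → ℕ → ℤ × ℤ → ℕ) (cE : ℕ → ℕ → ℕ → ℤ × ℤ → Fin 2 → ℕ × Bool),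
      (∀ k j, 8 ≤ k → Adm k j (V k j) (E k j) (Q k j) (σ k j) (τ k j) (bd k j) (cV k j) (cE k j)) → T

/-- **The crux holds with ANY conclusion** — in particular with `False`: protocol §3b "vacuous". -/
theorem withConclusion_all (T : Prop) : WithConclusion T :=
  fun _G _ _ _ _ _ _r V E Q σ τ bd cV cE hAdm => (hypotheses_unsatisfiable V E Q σ τ bd cV cE hAdm).elim

/-- Sanity (definitional agreement of the named `Adm` with the crux's inlined `(Φ k j).1`): the route decl BY NAME
from `hypotheses_unsatisfiable`, ignoring the anchor hypothesis.  (An `example`, not a landing: the item is closed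
by `Theorems.curvatureUniformity_proof`.) -/
example : Summit.QuantumFields.YangMills.Theses.HyperbolicRegulator.CurvatureUniformity := by
  intro G _ _ _ _ _hG r Fam₀ Sp₀ V E Q σ τ bd cV cE Φ hAdm _hAnch
  exact (hypotheses_unsatisfiable V E Q σ τ bd cV cE fun k j hk => hAdm k j hk).elim

/-- **`¬ CurvatureUniformity` is kernel-excluded**: the crux is a theorem of the tree
(`Theorems.curvatureUniformity_proof`), so no refutation can ever land for this typing. -/
theorem not_not_curvatureUniformity :
    ¬ ¬ Summit.QuantumFields.YangMills.Theses.HyperbolicRegulator.CurvatureUniformity :=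
  fun h => h Summit.QuantumFields.YangMills.Theorems.curvatureUniformity_proof

/-- For the record, the sibling refutation that BROKE the route (imported, not re-proved): the existence crux
`CurvatureAnchor` is false as typed, by the same `no_admissible`. -/
example : ¬ Summit.QuantumFields.YangMills.Theses.HyperbolicRegulator.CurvatureAnchor :=
  Summit.QuantumFields.YangMills.Theorems.not_CurvatureAnchor

/-! ## 2. Load-bearing analysis — see the module docstring, item 2 (degenerate: only `H_adm` at one scale). -/

/-- `H_adm` is needed only at ONE scale: admissibility at any single `k₀ ≥ 208` (and any `j₀`) already yields
`False`; the quantifier `∀ k ≥ 8` of the crux is used at a single instance. -/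
theorem adm_one_scale_unsat {k₀ j₀ : ℕ} (hk₀ : 208 ≤ k₀)
    (V E Q : Finset ℕ) (σ τ : ℕ → ℕ) (bd : ℕ → Fin 4 → ℕ × Bool) (cV : ℕ → ℤ × ℤ → ℕ)
    (cE : ℕ → ℤ × ℤ → Fin 2 → ℕ × Bool) : ¬ Adm k₀ j₀ V E Q σ τ bd cV cE :=
  no_admissible k₀ j₀ V E Q σ τ bd cV cE hk₀

/-! ## 3. Threshold bookkeeping (kernel-checked arithmetic for the restating seat)

`k / 4` is the chart sup-radius `R` (ℕ-division, as in the crux); a chart box reaches graph distance `2R` from its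
centre; its INTERIOR points (`‖a‖∞ ≤ R − 1`) reach `2(R − 1)`. -/

/-- **The typed slip bites exactly from `k = 12` on.**  With the typed flat threshold `k/4 < dist`, a flat vertex at
distance `k/4 + 1` from a cone sits at quadrant offset `(p, q)`, `p + q = k/4 + 1`; the cone is an INTERIOR chart
point (`p, q ≤ k/4 − 1`, possible iff `k/4 + 1 ≤ 2 (k/4 − 1)`) iff `k ≥ 12` — the R3 / VETTING mechanism
(`InteriorChartDegree`: an interior chart vertex is never a cone).  (`no_admissible` uses a different, shell-counting
contradiction and needs `k ≥ 208`; for `8 ≤ k < 12` neither mechanism excludes the intended family — a cone then meets a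
flat chart only on the boundary of the box, where the chart demands at most two squares and three edges at it.) -/
theorem old_slip_iff (k : ℕ) : k / 4 + 1 ≤ 2 * (k / 4 - 1) ↔ 12 ≤ k := by
  omega

/-- **R-a is consistent**: a chart box of sup-radius `k/4` has graph reach `2 (k/4) ≤ k/2`, so under the repaired
flat threshold `k/2 < dist x c` no cone lies in (let alone inside) a flat chart. -/
theorem repaired_reach_le_flat (k : ℕ) : 2 * (k / 4) ≤ k / 2 := by
  omega

/-- Chart-read observables of support radius `k/8` (the crux's `Sp A (k/8)`) read only chart edges: the far
endpoint of a support edge has coordinate `≤ k/8 + 1 ≤ k/4` for every `k ≥ 8` (and this fails at `k = 4..7`,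
irrelevant under the floor `8 ≤ k`). -/
theorem support_fits_chart (k : ℕ) (hk : 8 ≤ k) : k / 8 + 1 ≤ k / 4 := by
  omega

/-- The repaired deep threshold `3 (k/4)` (C′ of `not_CurvatureAnchor`) is strictly below the cone-density
radius `k` of clause 5, so clause 5 does not empty the deep set; in the intended model the deepest vertices have
nearest-cone distance exactly `k` (`k` even) — `CHI-BALLS.md`. -/
theorem deep_threshold_lt_density (k : ℕ) (hk : 8 ≤ k) : 3 * (k / 4) < k := by
  omega

end Summit.QuantumFields.YangMills.Cruxes.CurvatureUniformity.Disproof
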